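import Summits.MatrixMultiplication.OmegaCensus.ThreeSetZ5Z5PlaneCertificate1
import Summits.MatrixMultiplication.OmegaCensus.ThreeSetZ5Z13MomentCertificate1
import HarnessLib

/-!
# The dispatch predicate for pinned exceptions of `(1,9,12)@325`

ω-census `pub-omega`, family (b3), seat pub-omega-group gen 37 (staged for the successor).  Framing: lottery ticket; floor = certified
bounds/negative ranges.  VALUE: kernel computations / assembly of the `ℤ₅²` stage of the census cell `(1,9,12)@325` of `ℤ₅ × ℤ₆₅`
(design `HOME/pub-omega-group-g37/DESIGN-1-9-12.md`); NOT progress on ω.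
`pinOK19 σ excFlat p`: for the pin entry `p = (k, h, rows, λs)` of hole class `σ` — the pinning rows pass (`pinRowsOK1`), every fibre of `X`
(the exception `excFlat[k]`) is a singleton, and each support point's `𝔽₁₃` test vector passes (`momentCertOK1`).
-/

namespace Summit.MatrixMultiplication.OmegaCensus

namespace Z5Z5ThreeSet

open ZpZpDomino

/-- Dispatch predicate for one pin entry `(k, h, rows, λs)` of hole class `σ`. [folklore] -/
def pinOK19 (σ : ℕ) (excFlat : List (List ℕ)) (p : ℕ × List ℕ × List (ℕ × ℕ × List ℕ) × List (ℕ × List ℕ)) : Bool :=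
  pinRowsOK1 (excFlat.getD p.1 []) σ p.2.1 (zrows p.2.2.1) &&
    (List.range 25).all fun i => ((excFlat.getD p.1 []).getD i 0 == 0) ||
      (((excFlat.getD p.1 []).getD i 0 == 1) &&
        p.2.2.2.any fun lc => lc.1 == i && momentCertOK1 (excFlat.getD p.1 []) p.2.1 lc.2 (pt 5 i) (pt 5 σ))

end Z5Z5ThreeSet

end Summit.MatrixMultiplication.OmegaCensus
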